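import Summits.QuantumFields.YangMills.Theorems.BalabanUVNodesN19U3InputsReadBackFromStub1Face
import Summits.QuantumFields.YangMills.Theorems.BalabanUVNodesN19RateEdgeHolderD4AtCoreLedgerReadingFSC

/-!
# BalabanUVNodes ∕ N19 — THE N19′ FACE WITH ITS NODE-U3 INPUTS READ OFF STUB 1's FACE: under the (t-U3) pin the reading's node-U3 bundle is ONE object
# per `(F, θ)`, so the face's `N22At ∧ ReadOutAt ∧ ρ < 1` at the ONE tuple where stub 2's closer holds it transport everywhere; the consumers' `hdecT`
# follows from the face + the ONE letter row `∀ μ ν, KernelDecayOfRecord₁₃ … (ℓ F θ).κ`, and n19-w3's guard-generic N19′ slot — applied ONCE at the guard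
# «`G` ∧ the face's node-U3 conjuncts hold somewhere» — gives THE SAME SLOT WITH `hdecT` REPLACED BY THAT ROW and `hunif` by the bit `0 < ρ`

Cell `pub-ymgap`, HUMAN RULING D-0062 (Track A) ∕ D-0149 ∕ D-0154 (director-ym R399 (3a)), width seat `pub-ymgap-dag-n19-w5` (harness re-mint g3 of the
g0∕g1∕g2 lineage FILES 1–8), FILE 9.  THEOREMS ONLY (0 `def`, 0 `instance`, 0 `sorry`); imports this seat's FILE 8 `BalabanUVNodesN19U3InputsReadBackFromStub1Face`
(p639171; transitively FILES 2∕3∕5) and dag-n19-w3 g5's `BalabanUVNodesN19RateEdgeHolderD4AtCoreLedgerReadingFSC` (p638633) — CITED BY NAME, nothing restated or edited;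
mirror-free (NO Theses, NO `K3V6Defs`); `--kind proof --supports` K3⁸ `SpineGivenEndpointR13SepCoPHV` (stmt-QuantumFields-27366) `--as helper` — COUNT-NEUTRAL.

WHY.  Inside K3⁸'s registered `stub_expansion13HV` (skeleton «v6» b4e55110ab73e679) the closer holds stub 1's FACE — per guarded admissible tuple, inside `ForSmallCouplings`,
`PHolderD4 β D R` = `RatesHolderAt D R β ∧ ReadOutAt D R.u3 ∧ (0 ≤ R.u3.ρ ∧ R.u3.ρ < 1)` at `R := rateCarriersOfRecord₁₃CoPH 𝔯 F θ hP g₀ os k` — and must deliver the N19′ face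
`KeyedCoreEdgeHolderD4V β cr (rrOfRecord 𝔯 ksel)`.  Every N19′-slot supplier of record (dag-n19-w3 p607220 … p638633 ∕ p639369, the `…_finiteVolumeRows` bills p631491 … p638116 ∕
p638503) keys the slot's two node-U3 inputs on ROWS the closer is NOT handed: `hdecT` (⟸ `hs hL∕hinc h9` + the WINDOWED (5.10) letter `hWall` at 16 pairs, FILE 6) and `hunif` (⟸ `hs`,
FILE 5).  FILE 8 located: modulo the face AT ONE TUPLE, (T) ⟺ the LIMITING (5.10)-type letter `∀ μ ν, KernelDecayOfRecord₁₃ F N θ μ ν (ℓ F θ).κ` and `hunif` ⟺ the bit `0 < ρ`;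
referee ref-Q READ-101 (P1): «the closer must PROVE it or be HANDED it».  THIS FILE is the HANDED-IT edition: the N19′ slot whose ONLY node-U3 rows are that letter and that bit.

THE MECHANISM (kernel, three lines).  (i) TUPLE RIGIDITY: under the pin `(rateCarriersOfRecord₁₃CoPH 𝔯 F θ hP g₀ os k).u3 = u3OfRecord₁₃ θ (objectsOfRecord₁₃ F N θ (ℓ F θ)) k`
(FILE 2 `u3_rateCarriersOfRecord₁₃CoPH_of_pin`) and def-W1's objects of record are a FIXED-CARRIER reading (dag-n18-w2 `u3OfRecord₁₃_objectsOfRecord₁₃_eq`, `rfl`) — the node-U3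
bundle of the reading does not depend on `(g₀, os, k)` at all (§1).  (ii) So the face's node-U3 conjuncts at ANY ONE `(g₀, os, k)` give, with the letter ∀μν, (T) at EVERY `(g₀', os', k')`
and every tuning window `γ ≤ θ.γ` — the consumers' VERBATIM `hdecT` under the guard «`G θ` ∧ the face's `N22At ∧ ReadOutAt ∧ ρ < 1` hold at some tuple of `θ`» (§2; FILE 8 §4 +
FILE 2 `decayBound_window_mono`).  (iii) dag-n19-w3's slot theorems are GENERIC in the guard `G`: apply them ONCE at that conjunctive guard (NODE O's `hlinkCore` and every row weaken to
it by `.1`); at a tuple where the face holds NOWHERE the slot's conclusion `… face → core edge` is vacuous (`ForSmallCouplings.of_forall`) — one excluded middle (§3).  The uniform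
letters `(M, ρ₁)` of the slot are `(max 0 (cr·C₉·ω), ℓ.ρ)` from `0 < (ℓ F θ).ρ` (displayed) and `ρ < 1` (READ OFF THE FACE in the same branch) — §4.

WHAT.
* §1 [folklore] `u3_eq_of_u3Pinned` (the reading's node-U3 bundle at `(g₀, os, k)` IS the one at `(g₀', os', k')`); `faceU3_transport_of_u3Pinned` (`N22At ∧ ReadOutAt D ∧ ρ < 1` transport).
* §2 [bookkeeping] ★★ `hdecT_of_u3Pinned_of_kernelDecayAll_of_faceSomewhere` — the consumers' GLOBAL `hdecT` text (any guard `G`, generic `N`) from the letter row `h510` and «the face's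
  node-U3 conjuncts somewhere on each guarded admissible tuple»; `rho_row_of_rhoPos_of_faceSomewhere` (the row `0 < ρ < 1` from the bit `0 < ρ`, its `ρ < 1` half read off the face).
* §3 [bookkeeping] ★★★ `forSmallCouplings_h19HolderD4_datumOfRecord₁₃CoPH_of_linkReadingAtCoreLedgerReading_of_kernelDecayAll` — dag-n19-w3's `forSmallCouplings_h19HolderD4_…
  _of_linkReadingAtCoreLedgerReading` (p638633 §1) with the hypothesis `hdecT` REPLACED by `h510`, every other hypothesis and the conclusion LITERALLY theirs (generic `cr`, `G`, `N`).
* §4 [bookkeeping] ★★★ `keyedCoreEdgeHolderD4BFree_of_linkReadingAtCoreLedgerReading_of_kernelDecayAll_of_rhoPos` — K3 «v6»'s (B)-free N19′ face SPELLED (dag-n27-w1's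
  `K3V6Defs.KeyedCoreEdgeHolderD4BFree β cr (rrOfRecord 𝔯 ks)` unfolded; the text of p638116 §2's conclusion) from: NODE O's `hlinkCore`, the three pins, node N16's rows `hmatch hend
  hradii hclass`, `2∕3 < β ≤ 1`, K1⁷'s window `hβw` — AND ON THE NODE-U3 SIDE ONLY the letter row `h510` and the bit `hρ : 0 < (ℓ F θ).ρ`.  Compare p638116 §2 (`…_finiteVolumeRows`):
  there the node-U3 side costs `hs r hr hinc h9 hWall` (six rows, four of them about the WINDOWED finite-volume kernels).

LOCATED (count-neutral; for the plan's K3 «v7» precut — numbers, not adjectives).  Stub 2's node-U3 residue beyond stub 1's face, on the N19′ side, is EXACTLY two letter rows on the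
reading `ℓ` (both under `∀ F θ hP, G θ → θ.Admissible F N →`): (R1) `∀ μ ν : Fin 4, KernelDecayOfRecord₁₃ F N θ.toStage13Params μ ν (ℓ F θ).κ` — the LIMITING-kernel (5.10)-type letter
at all 16 direction pairs ([Balaban1987RG1] (5.10) p. 293 prints the windowed bound; stub 1's row list of record, dag-n27-w1 `K3V6StubsLetterForm` §4, carries `hW` = the WINDOWED letter at
the ONE pair `(0, 1)` plus `hL`, whence (R1) at `(0, 1)` only, `kernelDecayOfRecord₁₃_of_letters_guarded`); (R2) `0 < (ℓ F θ).ρ` (stub 1's `hs : Signs` gives it — `0 < θ₅ ≤ ρ` — its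
displayed `hρ` row says `0 ≤ ρ`).  At the witness reading `crOfRecord₁₃VAt` add n19-w3's (R3) `kappa₀ 64 8 ≤ (ℓ F θ).κ` (p638503 §1).  Everything else the N19′ suppliers asked of node U3
(`hs`, `hL`∕`r hr hinc`, `h9`, `hWall`, `hdecT`, `hunif`, `ρ < 1`) is READ OFF THE FACE or not needed.  Repair (b) of FILE 8 in minimal form: display (R1)(R2)[(R3)] — three `ℓ`-rows —
in `stub_expansion13HV`'s text (or in `GuardedReadingN16`, where stub 1's producer supplies them from def-W1's windowed letters at 16 pairs + `Signs`).

HONEST FRAMING.  `rfl`-transport, one excluded middle, and by-name applications of LANDED theorems over HYPOTHESIS shapes; ZERO estimate content; `hlinkCore` = NODE O's world at the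
record (UNPRINTED for d = 4; 0 instances); `h510`, `hρ`, node N16's rows, K1⁷'s window, the pins, `D.Tuned` are HYPOTHESES (inhabited for no family today — K0⁷ OPEN); nothing of
Bałaban's asserted or instantiated; (5.10)-at-the-record ∕ NE7 NOT PRINTED as such for d = 4 and NOT proved; N14 ∕ N16 ∕ N18 ∕ N19 ∕ N22 NOT discharged; no stub closed — NOT
`stub_rates13HV`, NOT `stub_expansion13HV`; K3⁸ OPEN, NOT claimed, skeleton v6 UNTOUCHED; K3⁷ aside; counts UNMOVED (typed 28∕28 · discharged 5∕27 · A 5∕28).  One finite 𝕋⁴ at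
fixed ε — R4 closes the CONDITIONAL rung `BalabanLadder.UV` only; NOT ℝ⁴ ∕ continuum ∕ OS; the Yang–Mills mass gap (Clay) is NOT proved by any of this.  [folklore] ∕ [bookkeeping].
-/

set_option autoImplicit false

noncomputable section

open Finset MeasureTheory
open scoped BigOperators Matrix Matrix.Norms.L2Operator

namespace Summit.QuantumFields.YangMills.BalabanUVNodes.N19CoreEdgeU3InputsFromFaceAtPin

open Literature.MathematicalPhysics.QuantumFieldTheory.Balaban1983to89
open T4OutputRate T4RecentScale T4GoodClassBudget T4CauchySum T4TowerRateComposition T4TowerRateDischarge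
open T4EtaRateMin (Readings NE3Shape)
open FlowStep (RGEqH prefixOf)
open TreeLengthTorus (TFaceConnected torusTreeLen)
open B12TreeDecay (kappa₀)
open Summit.QuantumFields.BalabanUV.T4Continuum
open MinimalActionSandwich (IsMinimiser minAct)
open MinimalActionRate (sfClass)
open MinimalActionRefine (RegularSup gradConst)
open NE3.LeafIndexSockets (LeafH3sup)
open Summit.QuantumFields.BalabanUV.T4Continuum.Spine
open Summit.QuantumFields.BalabanUV.T4Continuum.Spine.NE4 (runFlow)
open Summit.QuantumFields.YangMills.BalabanUVNodes.N19LedgerLinkSync (LedgerDataSync LedgerAtSync)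
open YMDAG.UVSplit (SpineCarriers U3Carriers RateCarriers N22At ReadOutAt)
open Summit.QuantumFields.YangMills.BalabanUVNodes.SpineRatesHolder (RatesHolderAt)
open Literature.MathematicalPhysics.QuantumFieldTheory.Balaban1983to89.T4Continuum (T4Family ULoop)
open YMDAG.UVSplit (Datum RateReading₁₃CoPH rateCarriersOfRecord₁₃CoPH)
open Node00 (Stage13HParams datumOfRecord₁₃CoPH NE3Letters₁₁ U3Letters₁₁)
open Summit.QuantumFields.YangMills.BalabanUVNodes.N16PinnedLayer13CoPH (N16PinnedLoose N16LettersEnd)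
open Literature.MathematicalPhysics.QuantumFieldTheory.Balaban1983to89.Node00.U3OfKernels (objectsOfRecord₁₃)

open T4ContinuumYM4Torus (ForSmallCouplings)
open YMDAG.N14.TopBorn (Ne1PinnedOfRecord)

open Literature.MathematicalPhysics.QuantumFieldTheory.Balaban1983to89.Node00.U3OfKernels (KernelDecayOfRecord₁₃)
open YMDAG.UVSplit (u3OfRecord₁₃)
open Summit.QuantumFields.YangMills.BalabanUVNodes.N19LinkReadingAtU3Pin (u3_rateCarriersOfRecord₁₃CoPH_of_pin decayBound_window_mono window_mono)
open Summit.QuantumFields.YangMills.BalabanUVNodes.N19UniformLettersAtU3Pin (hunif_of_u3Pinned_of_rho)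
open Summit.QuantumFields.YangMills.BalabanUVNodes.N19U3InputsReadBackFromStub1Face (decayBound_iff_kernelDecayOfRecord₁₃_of_face_of_u3Pinned rho_row_of_face_of_u3Pinned)
open Summit.QuantumFields.YangMills.BalabanUVNodes.N19RateEdgeHolderD4AtCoreLedgerReadingFSC (forSmallCouplings_h19HolderD4_datumOfRecord₁₃CoPH_of_linkReadingAtCoreLedgerReading)

variable {N : ℕ} [NeZero N]

/-! ## §1 Tuple rigidity of the pinned node-U3 bundle -/

section Rigid

variable (𝔯 : RateReading₁₃CoPH N) {F : T4Family} (θ : Stage13HParams F N) (hP : θ.Provisos₁₃CoPH F N) (ℓ : U3Letters₁₁)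
  (hpin : ∀ (g₀ : ℕ → ℝ) (os : List (ULoop F)), (𝔯.lit F θ hP g₀ os).u3 = objectsOfRecord₁₃ F N θ.toStage13Params ℓ)

include hpin

/-- **TUPLE RIGIDITY** [folklore]: under the (t-U3) pin the reading's node-U3 bundle at `(g₀, os, k)` IS the one at `(g₀', os', k')` — both are
`u3OfRecord₁₃ θ (objectsOfRecord₁₃ F N θ ℓ) ·` (FILE 2), a fixed-carrier reading (`rfl` in the run length; dag-n18-w2's `u3OfRecord₁₃_objectsOfRecord₁₃_eq`). -/
theorem u3_eq_of_u3Pinned (g₀ g₀' : ℕ → ℝ) (os os' : List (ULoop F)) (k k' : ℕ) :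
    (rateCarriersOfRecord₁₃CoPH 𝔯 F θ hP g₀ os k).u3 = (rateCarriersOfRecord₁₃CoPH 𝔯 F θ hP g₀' os' k').u3 := by
  rw [u3_rateCarriersOfRecord₁₃CoPH_of_pin 𝔯 θ hP g₀ os ℓ (hpin g₀ os) k, u3_rateCarriersOfRecord₁₃CoPH_of_pin 𝔯 θ hP g₀' os' ℓ (hpin g₀' os') k']
  rfl

/-- **THE FACE's NODE-U3 CONJUNCTS TRANSPORT** [folklore]: `N22At`, the (D4) read-out binders on the datum and `ρ < 1` at one `(g₀, os, k)` give the same at any `(g₀', os', k')`. -/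
theorem faceU3_transport_of_u3Pinned {g₀ : ℕ → ℝ} {os : List (ULoop F)} {k : ℕ}
    (h : N22At (rateCarriersOfRecord₁₃CoPH 𝔯 F θ hP g₀ os k).u3 ∧ ReadOutAt (datumOfRecord₁₃CoPH F N θ hP) (rateCarriersOfRecord₁₃CoPH 𝔯 F θ hP g₀ os k).u3 ∧
      (rateCarriersOfRecord₁₃CoPH 𝔯 F θ hP g₀ os k).u3.ρ < 1)
    (g₀' : ℕ → ℝ) (os' : List (ULoop F)) (k' : ℕ) :
    N22At (rateCarriersOfRecord₁₃CoPH 𝔯 F θ hP g₀' os' k').u3 ∧ ReadOutAt (datumOfRecord₁₃CoPH F N θ hP) (rateCarriersOfRecord₁₃CoPH 𝔯 F θ hP g₀' os' k').u3 ∧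
      (rateCarriersOfRecord₁₃CoPH 𝔯 F θ hP g₀' os' k').u3.ρ < 1 := by
  rwa [u3_eq_of_u3Pinned 𝔯 θ hP ℓ hpin g₀' g₀ os' os k' k]

end Rigid

/-! ## §2 The consumers' `hdecT` from the letter ∀μν and the face somewhere; `ρ < 1` read off the face -/

section Inputs

variable (𝔯 : RateReading₁₃CoPH N) (G : ∀ {F : T4Family}, Stage13HParams F N → Prop) (ℓ : (F : T4Family) → Stage13HParams F N → U3Letters₁₁)
  (hpinU3 : ∀ (F : T4Family) (θ : Stage13HParams F N) (hP : θ.Provisos₁₃CoPH F N) (g₀ : ℕ → ℝ) (os : List (ULoop F)),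
    (𝔯.lit F θ hP g₀ os).u3 = objectsOfRecord₁₃ F N θ.toStage13Params (ℓ F θ))

include hpinU3

/-- ★★ **THE CONSUMERS' `hdecT` FROM THE LETTER ROW ∀μν AND THE FACE SOMEWHERE** [bookkeeping]: under the (t-U3) pin, the LIMITING (5.10)-type letter of record
`∀ μ ν, KernelDecayOfRecord₁₃ F N θ μ ν (ℓ F θ).κ` at every guarded admissible tuple, together with the face's node-U3 conjuncts `N22At ∧ ReadOutAt D ∧ ρ < 1` at SOME `(g₀, os, k)`
of that tuple, give dag-n19-w3's VERBATIM bundle-decay clause: every window `γ ≤ θ.γ`, every `(g₀, os, k)`, `∃ E₀ ≥ 0, DecayBound R.u3.EA (Window γ) E₀ R.u3.κ` — FILE 8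
`decayBound_iff_kernelDecayOfRecord₁₃_of_face_of_u3Pinned` at the witness tuple (window `θ.γ`, `0 < θ.γ` by admissibility), §1's transport, FILE 2's window monotonicity.
(T) ∕ the letter are HYPOTHESES; N19 ∕ N22 NOT discharged. -/
theorem hdecT_of_u3Pinned_of_kernelDecayAll_of_faceSomewhere
    (h510 : ∀ (F : T4Family) (θ : Stage13HParams F N), θ.Provisos₁₃CoPH F N → G θ → θ.Admissible F N →
      ∀ μ ν : Fin 4, KernelDecayOfRecord₁₃ F N θ.toStage13Params μ ν (ℓ F θ).κ)
    (hface : ∀ (F : T4Family) (θ : Stage13HParams F N) (hP : θ.Provisos₁₃CoPH F N), G θ → θ.Admissible F N →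
      ∃ (g₀ : ℕ → ℝ) (os : List (ULoop F)) (k : ℕ), N22At (rateCarriersOfRecord₁₃CoPH 𝔯 F θ hP g₀ os k).u3 ∧
        ReadOutAt (datumOfRecord₁₃CoPH F N θ hP) (rateCarriersOfRecord₁₃CoPH 𝔯 F θ hP g₀ os k).u3 ∧ (rateCarriersOfRecord₁₃CoPH 𝔯 F θ hP g₀ os k).u3.ρ < 1) :
    ∀ (F : T4Family) (θ : Stage13HParams F N) (hP : θ.Provisos₁₃CoPH F N), G θ → θ.Admissible F N → ∀ γ : ℝ, γ ≤ θ.γ →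
      ∀ (g₀ : ℕ → ℝ) (os : List (ULoop F)) (k : ℕ), ∃ E₀ : ℝ, 0 ≤ E₀ ∧
        DecayBound (rateCarriersOfRecord₁₃CoPH 𝔯 F θ hP g₀ os k).u3.EA (Window γ) E₀ (rateCarriersOfRecord₁₃CoPH 𝔯 F θ hP g₀ os k).u3.κ := by
  intro F θ hP hG hθ γ hγ g₀ os k
  obtain ⟨g₁, os₁, k₁, h22, hD4, hρ1⟩ := hface F θ hP hG hθ
  obtain ⟨E₀, hE₀, hd⟩ := (decayBound_iff_kernelDecayOfRecord₁₃_of_face_of_u3Pinned 𝔯 θ hP g₁ os₁ (ℓ F θ) (hpinU3 F θ hP g₁ os₁) k₁ h22 hD4 hρ1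
    hθ.toStage9.gamma_pos).2 (h510 F θ hP hG hθ)
  refine ⟨E₀, hE₀, ?_⟩
  rw [u3_eq_of_u3Pinned 𝔯 θ hP (ℓ F θ) (hpinU3 F θ hP) g₀ g₁ os os₁ k k₁]
  exact decayBound_window_mono _ (window_mono hγ) hd

/-- **THE ROW `0 < ρ < 1` FROM THE BIT `0 < ρ` AND THE FACE SOMEWHERE** [bookkeeping]: the face's `ρ < 1` at one tuple IS the letter row `(ℓ F θ).ρ < 1` (FILE 5 `rho_eq_letter` via
FILE 8 `rho_row_of_face_of_u3Pinned`'s second half). -/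
theorem rho_row_of_rhoPos_of_faceSomewhere
    (hρ : ∀ (F : T4Family) (θ : Stage13HParams F N), θ.Provisos₁₃CoPH F N → G θ → θ.Admissible F N → 0 < (ℓ F θ).ρ)
    (hface : ∀ (F : T4Family) (θ : Stage13HParams F N) (hP : θ.Provisos₁₃CoPH F N), G θ → θ.Admissible F N →
      ∃ (g₀ : ℕ → ℝ) (os : List (ULoop F)) (k : ℕ), N22At (rateCarriersOfRecord₁₃CoPH 𝔯 F θ hP g₀ os k).u3 ∧
        ReadOutAt (datumOfRecord₁₃CoPH F N θ hP) (rateCarriersOfRecord₁₃CoPH 𝔯 F θ hP g₀ os k).u3 ∧ (rateCarriersOfRecord₁₃CoPH 𝔯 F θ hP g₀ os k).u3.ρ < 1) :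
    ∀ (F : T4Family) (θ : Stage13HParams F N), θ.Provisos₁₃CoPH F N → G θ → θ.Admissible F N → 0 < (ℓ F θ).ρ ∧ (ℓ F θ).ρ < 1 := by
  intro F θ hP hG hθ
  obtain ⟨g₁, os₁, k₁, -, -, hρ1⟩ := hface F θ hP hG hθ
  refine ⟨hρ F θ hP hG hθ, ?_⟩
  rwa [u3_rateCarriersOfRecord₁₃CoPH_of_pin 𝔯 θ hP g₁ os₁ (ℓ F θ) (hpinU3 F θ hP g₁ os₁) k₁] at hρ1

end Inputs

/-! ## §3 dag-n19-w3's N19′ slot at the core ledger reading WITH `hdecT` REPLACED BY THE LETTER ROW ∀μν -/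

section Slot

variable
  (cr : (F : T4Family) → (θ : Stage13HParams F N) → θ.Provisos₁₃CoPH F N → (ℕ → ℝ) → List (ULoop F) → SpineCarriers)
  (𝔯 : RateReading₁₃CoPH N) (G : ∀ {F : T4Family}, Stage13HParams F N → Prop) {β : ℝ} (hβ1 : β ≤ 1)
  {ℓ₃ : T4Family → NE3Letters₁₁} {g B c' : T4Family → ℝ}

include hβ1 in
/-- ★★★ **N19′'s SLOT UNDER THE `ForSmallCouplings` PREFIX AT THE CORE LEDGER READING, `hdecT` ↦ THE LETTER ROW ∀μν** [bookkeeping]: dag-n19-w3 g5's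
`forSmallCouplings_h19HolderD4_datumOfRecord₁₃CoPH_of_linkReadingAtCoreLedgerReading` (p638633 §1) — hypotheses `hlinkCore` (NODE O's core ledger reading), `2∕3 < β ≤ 1`, the three pins,
node N16's rows, `D`'s K1⁷ window, the uniform letters `(M, ρ₁)` LITERALLY theirs; the bundle-decay clause `hdecT` is GONE, replaced by `h510 : ∀ F θ hP, G θ → θ.Admissible F N →
∀ μ ν, KernelDecayOfRecord₁₃ F N θ μ ν (ℓ F θ).κ`.  Proof: excluded middle on «the face's `N22At ∧ ReadOutAt ∧ ρ < 1` hold at some `(g₀, os, k)` of this tuple»; if so, their theorem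
at the guard `G θ ∧ ∃ hP g₀ os k, …` (`hlinkCore` weakened by `.1`, `hdecT` by §2); if not, the slot is vacuous in the face (`ForSmallCouplings.of_forall`; `RatesHolderAt`'s last conjunct
is `N22At`).  All HYPOTHESES; NOT NE7; N14 ∕ N16 ∕ N19 ∕ N22 NOT discharged; NOT `stub_expansion13HV`. -/
theorem forSmallCouplings_h19HolderD4_datumOfRecord₁₃CoPH_of_linkReadingAtCoreLedgerReading_of_kernelDecayAll
    (hlinkCore : ∀ (F : T4Family) (θ : Stage13HParams F N) (hP : θ.Provisos₁₃CoPH F N), G θ → θ.Admissible F N →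
    ∀ (γ gIR b : ℝ) (g₀ : ℕ → ℝ), (datumOfRecord₁₃CoPH F N θ hP).Tuned γ gIR g₀ → γ ≤ θ.γ → γ ^ 2 ≤ Real.exp (-1) → 0 < b →
    (∀ K m, 0 ≤ m → m < K → b ≤ (datumOfRecord₁₃CoPH F N θ hP).βfun m (prefixOf (runFlow (datumOfRecord₁₃CoPH F N θ hP) g₀ K) m)) →
    ∀ (os : List (ULoop F)) (k : ℕ),
      let S : SpineCarriers := cr F θ hP g₀ os
      let R : RateCarriers N := rateCarriersOfRecord₁₃CoPH 𝔯 F θ hP g₀ os k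
      let D : Datum F N := datumOfRecord₁₃CoPH F N θ hP
      letI := S.dec
      ∃ (_ : DecidableEq R.u3.C.Dom) (F' : Type) (ι' X' : Type) (_ : MeasurableSpace ι')
        (L : LedgerDataSync R.u3.C F' ι' S.ι) (Rd : Readings ι' X') (bsel : (ℕ → ℝ) → ℝ) (EB : Functional R.u3.C R.u3.C.BgB)
        (g : ℕ → ℕ → ℝ)
        (uA : ℕ → ι' → R.u3.C.BgA) (uB : ℕ → ι' → R.u3.C.BgB)
        (Pf : ℕ → Params) (d₀ L₀ Koff : ℕ) (cells : (K j : ℕ) → R.u3.C.Dom → Finset (Site (Pf K) j))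
        (θ : ℝ)
        (sel : ℕ → (B7Prop1Explicit.Site 4 → Fin 4 → (Matrix (Fin N) (Fin N) ℂ)ˣ) → (B7Prop1Explicit.Site 4 → Fin 4 → (Matrix (Fin N) (Fin N) ℂ)ˣ))
        (rd : ι' → (B7Prop1Explicit.Site 4 → Fin 4 → (Matrix (Fin N) (Fin N) ℂ)ˣ)),
        (∀ K i, i ≤ K → g K i = runFlow D g₀ K i) ∧ (∀ K i, K < i → g K i = gIR) ∧
        EB = (fun s => R.u3.EB (bsel s) s) ∧
        (∀ (Sz : ℕ → ℝ → S.ι → ℕ → ℝ) (E₀ : ℝ) (m : ℕ) (a : ℝ) (Cw Λg : ℝ),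
          (∀ K t, |t| ≤ S.l₀ → ∀ τ ∈ S.T K \ S.Bad K t, ∀ v ∈ Rd.dom, ∀ j ≤ K,
            |∑ X ∈ L.fac K t τ with R.u3.C.scale X = j,
                (Real.log (Real.exp (EB (fun i => g (K + 1) (i + 1)) (uB K v) X
                    - EB (fun i => g (K + 1) (i + 1)) L.oneB X))
                  - Real.log (Real.exp (R.u3.EA (g K) (uA K v) X - R.u3.EA (g K) L.oneA X)))| ≤ Sz K t τ j) →
          0 ≤ E₀ → 0 < a → a < 1 →
          (∀ K t, |t| ≤ S.l₀ → ∀ τ ∈ S.T K \ S.Bad K t, ∀ j ≤ K,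
            Sz K t τ j ≤ S.vol * (E₀ * ((K : ℝ) + 1) ^ m * a ^ (K - j))) →
          (∀ K, Multiplicity (L.All K) R.u3.C.scale (fun X => Real.exp (-(R.u3.κ * R.u3.C.d X))) Cw S.vol Λg K) →
          (∀ K t, |t| ≤ S.l₀ → ∀ τ ∈ S.T K \ S.Bad K t,
            WindowMultiplicity (L.facO K t τ) L.scO L.wO Cw S.vol Λg (jlogOf L.Cl K) K) →
          1 ≤ Λg → L.θ' ≤ Λg →
          LedgerAtSync { L with S := Sz, E₀ := E₀, m := m, a := a, Cw := Cw, Λg := Λg } S.l₀ S.vol S.T S.Bad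
            (fun K t τ => S.A K t τ - S.shA K t τ) (fun K t τ => S.B K t τ - S.shB K t τ) Rd R.u3.EA EB R.u3.κ g uA uB
            R.u3.ω R.u3.ρ R.u3.θ (θ ^ ((3 : ℝ) * β - 2))) ∧
        0 ≤ S.vol ∧
        (∀ K t, |t| ≤ S.l₀ → ∀ τ ∈ S.T K \ S.Bad K t,
          WindowMultiplicity (L.facO K t τ) L.scO L.wO L.Cw S.vol L.Λg (jlogOf L.Cl K) K) ∧
        0 ≤ L.Cw ∧ 1 ≤ L.Λg ∧ L.θ' ≤ L.Λg ∧
        (∀ K, (Pf K).d = d₀) ∧ (∀ K, (Pf K).L = L₀) ∧ (∀ K, (Pf K).K = Koff + K) ∧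
        (∀ K, (Fintype.card (Site (Pf K) (Pf K).K) : ℝ) = S.vol) ∧
        kappa₀ (4 * 2 ^ d₀) (2 * d₀) ≤ R.u3.κ ∧
        (∀ K, ∀ X ∈ L.All K,
          (cells K (R.u3.C.scale X + Koff) X).Nonempty ∧ TFaceConnected (cells K (R.u3.C.scale X + Koff) X)) ∧
        (∀ K j, Set.InjOn (cells K j) ↑((L.All K).filter fun X => R.u3.C.scale X + Koff = j)) ∧
        (∀ K, ∀ X ∈ L.All K, torusTreeLen (cells K (R.u3.C.scale X + Koff) X) ≤ R.u3.C.d X) ∧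
        LeafH3sup 4 R.ne3.L R.ne3.Nper R.ne3.ε R.ne3.b (c' F) R.ne3.dom ∧
        (∀ V ∈ R.ne3.dom, ∀ k : ℕ, IsMinimiser 4 (sfClass 4 R.ne3.L R.ne3.Nper R.ne3.ε) R.ne3.L R.ne3.Nper k V (sel k V)) ∧
        (∀ V ∈ R.ne3.dom, ∀ k : ℕ, RegularSup 4 R.ne3.L R.ne3.Nper R.ne3.b (c' F) k (sel k V)) ∧
        0 < θ ∧ θ ^ 6 = ((R.ne3.L : ℝ))⁻¹ ∧
        (∀ v ∈ Rd.dom, rd v ∈ R.ne3.dom) ∧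
        (∀ k, ∀ v ∈ Rd.dom, Rd.act k v = minAct 4 (sfClass 4 R.ne3.L R.ne3.Nper R.ne3.ε) R.ne3.L R.ne3.Nper k (rd v)) ∧
        (R.ne3.Nper : ℝ) ^ 4 ≤ Rd.vol ∧
        (∀ s ∈ Window γ, 0 < bsel s ∧ bsel s ≤ γ))
    (hβ23 : 2 / 3 < β) (hpin1 : Ne1PinnedOfRecord 𝔯)
    (ℓ : (F : T4Family) → Stage13HParams F N → U3Letters₁₁)
    (hpinU3 : ∀ (F : T4Family) (θ : Stage13HParams F N) (hP : θ.Provisos₁₃CoPH F N) (g₀ : ℕ → ℝ) (os : List (ULoop F)),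
      (𝔯.lit F θ hP g₀ os).u3 = objectsOfRecord₁₃ F N θ.toStage13Params (ℓ F θ))
    (hpinL : N16PinnedLoose 𝔯 ℓ₃ B) (hmatch : ∀ F : T4Family, 0 < B F ∧ (ℓ₃ F).ε / B F ≤ (ℓ₃ F).b) (hend : N16LettersEnd N g ℓ₃)
    (hradii : ∀ F : T4Family, (ℓ₃ F).g = gradConst 4 (c' F) ∧ 0 ≤ c' F ∧ 0 < c' F ∧ (ℓ₃ F).b ≤ c' F ∧
      (2 : ℝ) ^ 91 * (F.L : ℝ) ^ 17 * c' F ≤ 1 ∧ (2 : ℝ) ^ 76 * (F.L : ℝ) ^ 12 * c' F ≤ (ℓ₃ F).ε ∧ (ℓ₃ F).ε / B F ≤ 1 / 4 ∧ 4 * ((ℓ₃ F).ε / B F) ≤ c' F)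
    (hclass : ∀ F : T4Family, 16 * B7Prop2Explicit.C0 4 * (ℓ₃ F).ε ≤ 3 ∧ 1024 * (4 + 1) * (4 + 4) * (F.L : ℝ) ^ 2 * (ℓ₃ F).ε ≤ 1)
    (h510 : ∀ (F : T4Family) (θ : Stage13HParams F N), θ.Provisos₁₃CoPH F N → G θ → θ.Admissible F N →
      ∀ μ ν : Fin 4, KernelDecayOfRecord₁₃ F N θ.toStage13Params μ ν (ℓ F θ).κ)
    (F : T4Family) (θ : Stage13HParams F N) (hP : θ.Provisos₁₃CoPH F N) (hG : G θ) (hθ : θ.Admissible F N) {γ₀ b b' : ℝ} (hγ₀ : 0 < γ₀) (hb0 : 0 < b)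
    (hβ : DagBinding.BetaBoundsInInterval (datumOfRecord₁₃CoPH F N θ hP).C.toB12 γ₀ b b') {M ρ₁ : ℝ} (hM : 0 ≤ M) (hρ₁ : ρ₁ < 1)
    (hunif : ∀ (g₀ : ℕ → ℝ) (os : List (ULoop F)) (k : ℕ), 0 < (rateCarriersOfRecord₁₃CoPH 𝔯 F θ hP g₀ os k).u3.ρ ∧
      (rateCarriersOfRecord₁₃CoPH 𝔯 F θ hP g₀ os k).u3.ρ ≤ ρ₁ ∧
      (rateCarriersOfRecord₁₃CoPH 𝔯 F θ hP g₀ os k).u3.cr * (rateCarriersOfRecord₁₃CoPH 𝔯 F θ hP g₀ os k).u3.C₉ * (rateCarriersOfRecord₁₃CoPH 𝔯 F θ hP g₀ os k).u3.ω ≤ M) :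
    ForSmallCouplings (datumOfRecord₁₃CoPH F N θ hP) fun g₀ => ∀ (os : List (ULoop F)) (k : ℕ),
      (RatesHolderAt (datumOfRecord₁₃CoPH F N θ hP) (rateCarriersOfRecord₁₃CoPH 𝔯 F θ hP g₀ os k) β ∧
        ReadOutAt (datumOfRecord₁₃CoPH F N θ hP) (rateCarriersOfRecord₁₃CoPH 𝔯 F θ hP g₀ os k).u3 ∧
        (0 ≤ (rateCarriersOfRecord₁₃CoPH 𝔯 F θ hP g₀ os k).u3.ρ ∧ (rateCarriersOfRecord₁₃CoPH 𝔯 F θ hP g₀ os k).u3.ρ < 1)) →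
      letI := (cr F θ hP g₀ os).dec
      ∃ δ : ℕ → ℝ, NE7.Core (cr F θ hP g₀ os).l₀ (cr F θ hP g₀ os).vol (cr F θ hP g₀ os).T (cr F θ hP g₀ os).Bad
        (fun K t τ => (cr F θ hP g₀ os).A K t τ - (cr F θ hP g₀ os).shA K t τ) (fun K t τ => (cr F θ hP g₀ os).B K t τ - (cr F θ hP g₀ os).shB K t τ) δ ∧
        Summable δ := by
  classical
  by_cases hfs : ∃ (g₀ : ℕ → ℝ) (os : List (ULoop F)) (k : ℕ), N22At (rateCarriersOfRecord₁₃CoPH 𝔯 F θ hP g₀ os k).u3 ∧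
      ReadOutAt (datumOfRecord₁₃CoPH F N θ hP) (rateCarriersOfRecord₁₃CoPH 𝔯 F θ hP g₀ os k).u3 ∧ (rateCarriersOfRecord₁₃CoPH 𝔯 F θ hP g₀ os k).u3.ρ < 1
  · exact forSmallCouplings_h19HolderD4_datumOfRecord₁₃CoPH_of_linkReadingAtCoreLedgerReading cr 𝔯
      (fun {F} θ => G θ ∧ ∃ (hP : θ.Provisos₁₃CoPH F N) (g₀ : ℕ → ℝ) (os : List (ULoop F)) (k : ℕ),
        N22At (rateCarriersOfRecord₁₃CoPH 𝔯 F θ hP g₀ os k).u3 ∧ ReadOutAt (datumOfRecord₁₃CoPH F N θ hP) (rateCarriersOfRecord₁₃CoPH 𝔯 F θ hP g₀ os k).u3 ∧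
          (rateCarriersOfRecord₁₃CoPH 𝔯 F θ hP g₀ os k).u3.ρ < 1)
      hβ1 (fun F θ hP hG' => hlinkCore F θ hP hG'.1) hβ23 hpin1 ℓ hpinU3 hpinL hmatch hend hradii hclass
      (hdecT_of_u3Pinned_of_kernelDecayAll_of_faceSomewhere 𝔯 _ ℓ hpinU3 (fun F θ hP hG' hθ => h510 F θ hP hG'.1 hθ)
        fun F θ hP hG' _ => let ⟨_, g₁, os₁, k₁, h⟩ := hG'.2; ⟨g₁, os₁, k₁, h⟩)
      F θ hP ⟨hG, hP, hfs⟩ hθ hγ₀ hb0 hβ hM hρ₁ hunif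
  · exact ForSmallCouplings.of_forall fun g₀ os k hface => absurd ⟨g₀, os, k, hface.1.2.2.2.2.2, hface.2.1, hface.2.2.2⟩ hfs

/-! ## §4 K3 «v6»'s (B)-free N19′ face, SPELLED, at the core ledger reading — node-U3 side = the letter row ∀μν and the bit `0 < ρ` -/

include hβ1 in
/-- ★★★ **K3 «v6»'s (B)-FREE N19′ FACE `KeyedCoreEdgeHolderD4BFree β cr (rrOfRecord 𝔯 ks)`, SPELLED, AT THE CORE LEDGER READING — NODE U3's SHARE = TWO LETTER ROWS**
[bookkeeping]: the conclusion of dag-n19-w3's p638116 §2 `keyedCoreEdgeHolderD4BFree_of_linkReadingAtCoreLedgerReading_finiteVolumeRows` (generic `N`, `G`, `cr`; at `N = 2`,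
`G θ := θ.ZhUnity F 2 ∧ θ.SlotsNondegenerate₁₃ F 2` it is dag-n27-w1's `K3V6Defs.KeyedCoreEdgeHolderD4BFree β cr (rrOfRecord 𝔯 ks)` unfolded) from: NODE O's `hlinkCore`, `2∕3 < β ≤ 1`,
the three pins, node N16's rows `hmatch hend hradii hclass`, K1⁷'s interval-form window with `0 < b` (`hβw`), and — on node U3's side — ONLY `h510` (the LIMITING (5.10)-type letter, 16
pairs) and `hρ : 0 < (ℓ F θ).ρ`.  The slot's uniform letters are `(max 0 (cr·C₉·ω), ℓ.ρ)` (FILE 5 `hunif_of_u3Pinned_of_rho`) with `ρ < 1` READ OFF THE FACE in the branch where the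
face holds somewhere (§2); the other branch is vacuous.  p638116 §2 asks node U3 for `hs r hr hinc h9 hWall` instead.  All HYPOTHESES; NOT the stub, NOT K3⁸; N14 ∕ N16 ∕ N18 ∕ N19 ∕
N22 NOT discharged. -/
theorem keyedCoreEdgeHolderD4BFree_of_linkReadingAtCoreLedgerReading_of_kernelDecayAll_of_rhoPos
    (hlinkCore : ∀ (F : T4Family) (θ : Stage13HParams F N) (hP : θ.Provisos₁₃CoPH F N), G θ → θ.Admissible F N →
    ∀ (γ gIR b : ℝ) (g₀ : ℕ → ℝ), (datumOfRecord₁₃CoPH F N θ hP).Tuned γ gIR g₀ → γ ≤ θ.γ → γ ^ 2 ≤ Real.exp (-1) → 0 < b →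
    (∀ K m, 0 ≤ m → m < K → b ≤ (datumOfRecord₁₃CoPH F N θ hP).βfun m (prefixOf (runFlow (datumOfRecord₁₃CoPH F N θ hP) g₀ K) m)) →
    ∀ (os : List (ULoop F)) (k : ℕ),
      let S : SpineCarriers := cr F θ hP g₀ os
      let R : RateCarriers N := rateCarriersOfRecord₁₃CoPH 𝔯 F θ hP g₀ os k
      let D : Datum F N := datumOfRecord₁₃CoPH F N θ hP
      letI := S.dec
      ∃ (_ : DecidableEq R.u3.C.Dom) (F' : Type) (ι' X' : Type) (_ : MeasurableSpace ι')
        (L : LedgerDataSync R.u3.C F' ι' S.ι) (Rd : Readings ι' X') (bsel : (ℕ → ℝ) → ℝ) (EB : Functional R.u3.C R.u3.C.BgB)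
        (g : ℕ → ℕ → ℝ)
        (uA : ℕ → ι' → R.u3.C.BgA) (uB : ℕ → ι' → R.u3.C.BgB)
        (Pf : ℕ → Params) (d₀ L₀ Koff : ℕ) (cells : (K j : ℕ) → R.u3.C.Dom → Finset (Site (Pf K) j))
        (θ : ℝ)
        (sel : ℕ → (B7Prop1Explicit.Site 4 → Fin 4 → (Matrix (Fin N) (Fin N) ℂ)ˣ) → (B7Prop1Explicit.Site 4 → Fin 4 → (Matrix (Fin N) (Fin N) ℂ)ˣ))
        (rd : ι' → (B7Prop1Explicit.Site 4 → Fin 4 → (Matrix (Fin N) (Fin N) ℂ)ˣ)),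
        (∀ K i, i ≤ K → g K i = runFlow D g₀ K i) ∧ (∀ K i, K < i → g K i = gIR) ∧
        EB = (fun s => R.u3.EB (bsel s) s) ∧
        (∀ (Sz : ℕ → ℝ → S.ι → ℕ → ℝ) (E₀ : ℝ) (m : ℕ) (a : ℝ) (Cw Λg : ℝ),
          (∀ K t, |t| ≤ S.l₀ → ∀ τ ∈ S.T K \ S.Bad K t, ∀ v ∈ Rd.dom, ∀ j ≤ K,
            |∑ X ∈ L.fac K t τ with R.u3.C.scale X = j,
                (Real.log (Real.exp (EB (fun i => g (K + 1) (i + 1)) (uB K v) X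
                    - EB (fun i => g (K + 1) (i + 1)) L.oneB X))
                  - Real.log (Real.exp (R.u3.EA (g K) (uA K v) X - R.u3.EA (g K) L.oneA X)))| ≤ Sz K t τ j) →
          0 ≤ E₀ → 0 < a → a < 1 →
          (∀ K t, |t| ≤ S.l₀ → ∀ τ ∈ S.T K \ S.Bad K t, ∀ j ≤ K,
            Sz K t τ j ≤ S.vol * (E₀ * ((K : ℝ) + 1) ^ m * a ^ (K - j))) →
          (∀ K, Multiplicity (L.All K) R.u3.C.scale (fun X => Real.exp (-(R.u3.κ * R.u3.C.d X))) Cw S.vol Λg K) →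
          (∀ K t, |t| ≤ S.l₀ → ∀ τ ∈ S.T K \ S.Bad K t,
            WindowMultiplicity (L.facO K t τ) L.scO L.wO Cw S.vol Λg (jlogOf L.Cl K) K) →
          1 ≤ Λg → L.θ' ≤ Λg →
          LedgerAtSync { L with S := Sz, E₀ := E₀, m := m, a := a, Cw := Cw, Λg := Λg } S.l₀ S.vol S.T S.Bad
            (fun K t τ => S.A K t τ - S.shA K t τ) (fun K t τ => S.B K t τ - S.shB K t τ) Rd R.u3.EA EB R.u3.κ g uA uB
            R.u3.ω R.u3.ρ R.u3.θ (θ ^ ((3 : ℝ) * β - 2))) ∧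
        0 ≤ S.vol ∧
        (∀ K t, |t| ≤ S.l₀ → ∀ τ ∈ S.T K \ S.Bad K t,
          WindowMultiplicity (L.facO K t τ) L.scO L.wO L.Cw S.vol L.Λg (jlogOf L.Cl K) K) ∧
        0 ≤ L.Cw ∧ 1 ≤ L.Λg ∧ L.θ' ≤ L.Λg ∧
        (∀ K, (Pf K).d = d₀) ∧ (∀ K, (Pf K).L = L₀) ∧ (∀ K, (Pf K).K = Koff + K) ∧
        (∀ K, (Fintype.card (Site (Pf K) (Pf K).K) : ℝ) = S.vol) ∧
        kappa₀ (4 * 2 ^ d₀) (2 * d₀) ≤ R.u3.κ ∧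
        (∀ K, ∀ X ∈ L.All K,
          (cells K (R.u3.C.scale X + Koff) X).Nonempty ∧ TFaceConnected (cells K (R.u3.C.scale X + Koff) X)) ∧
        (∀ K j, Set.InjOn (cells K j) ↑((L.All K).filter fun X => R.u3.C.scale X + Koff = j)) ∧
        (∀ K, ∀ X ∈ L.All K, torusTreeLen (cells K (R.u3.C.scale X + Koff) X) ≤ R.u3.C.d X) ∧
        LeafH3sup 4 R.ne3.L R.ne3.Nper R.ne3.ε R.ne3.b (c' F) R.ne3.dom ∧
        (∀ V ∈ R.ne3.dom, ∀ k : ℕ, IsMinimiser 4 (sfClass 4 R.ne3.L R.ne3.Nper R.ne3.ε) R.ne3.L R.ne3.Nper k V (sel k V)) ∧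
        (∀ V ∈ R.ne3.dom, ∀ k : ℕ, RegularSup 4 R.ne3.L R.ne3.Nper R.ne3.b (c' F) k (sel k V)) ∧
        0 < θ ∧ θ ^ 6 = ((R.ne3.L : ℝ))⁻¹ ∧
        (∀ v ∈ Rd.dom, rd v ∈ R.ne3.dom) ∧
        (∀ k, ∀ v ∈ Rd.dom, Rd.act k v = minAct 4 (sfClass 4 R.ne3.L R.ne3.Nper R.ne3.ε) R.ne3.L R.ne3.Nper k (rd v)) ∧
        (R.ne3.Nper : ℝ) ^ 4 ≤ Rd.vol ∧
        (∀ s ∈ Window γ, 0 < bsel s ∧ bsel s ≤ γ))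
    (hβ23 : 2 / 3 < β) (hpin1 : Ne1PinnedOfRecord 𝔯)
    (ℓ : (F : T4Family) → Stage13HParams F N → U3Letters₁₁)
    (hpinU3 : ∀ (F : T4Family) (θ : Stage13HParams F N) (hP : θ.Provisos₁₃CoPH F N) (g₀ : ℕ → ℝ) (os : List (ULoop F)),
      (𝔯.lit F θ hP g₀ os).u3 = objectsOfRecord₁₃ F N θ.toStage13Params (ℓ F θ))
    (hpinL : N16PinnedLoose 𝔯 ℓ₃ B) (hmatch : ∀ F : T4Family, 0 < B F ∧ (ℓ₃ F).ε / B F ≤ (ℓ₃ F).b) (hend : N16LettersEnd N g ℓ₃)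
    (hradii : ∀ F : T4Family, (ℓ₃ F).g = gradConst 4 (c' F) ∧ 0 ≤ c' F ∧ 0 < c' F ∧ (ℓ₃ F).b ≤ c' F ∧
      (2 : ℝ) ^ 91 * (F.L : ℝ) ^ 17 * c' F ≤ 1 ∧ (2 : ℝ) ^ 76 * (F.L : ℝ) ^ 12 * c' F ≤ (ℓ₃ F).ε ∧ (ℓ₃ F).ε / B F ≤ 1 / 4 ∧ 4 * ((ℓ₃ F).ε / B F) ≤ c' F)
    (hclass : ∀ F : T4Family, 16 * B7Prop2Explicit.C0 4 * (ℓ₃ F).ε ≤ 3 ∧ 1024 * (4 + 1) * (4 + 4) * (F.L : ℝ) ^ 2 * (ℓ₃ F).ε ≤ 1)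
    (h510 : ∀ (F : T4Family) (θ : Stage13HParams F N), θ.Provisos₁₃CoPH F N → G θ → θ.Admissible F N →
      ∀ μ ν : Fin 4, KernelDecayOfRecord₁₃ F N θ.toStage13Params μ ν (ℓ F θ).κ)
    (hρ : ∀ (F : T4Family) (θ : Stage13HParams F N), θ.Provisos₁₃CoPH F N → G θ → θ.Admissible F N → 0 < (ℓ F θ).ρ)
    (ks : (F : T4Family) → (θ : Stage13HParams F N) → θ.Provisos₁₃CoPH F N → (ℕ → ℝ) → List (ULoop F) → ℕ)
    (hβw : ∀ (F : T4Family) (θ : Stage13HParams F N) (hP : θ.Provisos₁₃CoPH F N), G θ → θ.Admissible F N →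
      ∃ γ₀ b b' : ℝ, 0 < γ₀ ∧ 0 < b ∧ DagBinding.BetaBoundsInInterval (datumOfRecord₁₃CoPH F N θ hP).C.toB12 γ₀ b b') :
    ∀ (F : T4Family) (θ : Stage13HParams F N) (hP : θ.Provisos₁₃CoPH F N), G θ → θ.Admissible F N →
      ForSmallCouplings (datumOfRecord₁₃CoPH F N θ hP) fun g₀ => ∀ os : List (ULoop F),
        (RatesHolderAt (datumOfRecord₁₃CoPH F N θ hP) (rateCarriersOfRecord₁₃CoPH 𝔯 F θ hP g₀ os (ks F θ hP g₀ os)) β ∧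
          ReadOutAt (datumOfRecord₁₃CoPH F N θ hP) (rateCarriersOfRecord₁₃CoPH 𝔯 F θ hP g₀ os (ks F θ hP g₀ os)).u3 ∧
          (0 ≤ (rateCarriersOfRecord₁₃CoPH 𝔯 F θ hP g₀ os (ks F θ hP g₀ os)).u3.ρ ∧ (rateCarriersOfRecord₁₃CoPH 𝔯 F θ hP g₀ os (ks F θ hP g₀ os)).u3.ρ < 1)) →
      letI := (cr F θ hP g₀ os).dec
      ∃ δ : ℕ → ℝ, NE7.Core (cr F θ hP g₀ os).l₀ (cr F θ hP g₀ os).vol (cr F θ hP g₀ os).T (cr F θ hP g₀ os).Bad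
        (fun K t τ => (cr F θ hP g₀ os).A K t τ - (cr F θ hP g₀ os).shA K t τ) (fun K t τ => (cr F θ hP g₀ os).B K t τ - (cr F θ hP g₀ os).shB K t τ) δ ∧
        Summable δ := by
  classical
  intro F θ hP hG hθ
  obtain ⟨γ₀, b, b', hγ₀, hb0, hβ⟩ := hβw F θ hP hG hθ
  by_cases hfs : ∃ (g₀ : ℕ → ℝ) (os : List (ULoop F)) (k : ℕ), N22At (rateCarriersOfRecord₁₃CoPH 𝔯 F θ hP g₀ os k).u3 ∧
      ReadOutAt (datumOfRecord₁₃CoPH F N θ hP) (rateCarriersOfRecord₁₃CoPH 𝔯 F θ hP g₀ os k).u3 ∧ (rateCarriersOfRecord₁₃CoPH 𝔯 F θ hP g₀ os k).u3.ρ < 1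
  · -- the face's node-U3 conjuncts hold somewhere on this tuple: their slot at the conjunctive guard, `hdecT` by §2, `(M, ρ₁)` from `0 < ρ` and the face's `ρ < 1`
    have hunif := hunif_of_u3Pinned_of_rho 𝔯
      (fun {F} θ => G θ ∧ ∃ (hP : θ.Provisos₁₃CoPH F N) (g₀ : ℕ → ℝ) (os : List (ULoop F)) (k : ℕ),
        N22At (rateCarriersOfRecord₁₃CoPH 𝔯 F θ hP g₀ os k).u3 ∧ ReadOutAt (datumOfRecord₁₃CoPH F N θ hP) (rateCarriersOfRecord₁₃CoPH 𝔯 F θ hP g₀ os k).u3 ∧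
          (rateCarriersOfRecord₁₃CoPH 𝔯 F θ hP g₀ os k).u3.ρ < 1)
      ℓ hpinU3
      (rho_row_of_rhoPos_of_faceSomewhere 𝔯 _ ℓ hpinU3 (fun F θ hP hG' hθ => hρ F θ hP hG'.1 hθ)
        fun F θ hP hG' _ => let ⟨_, g₁, os₁, k₁, h⟩ := hG'.2; ⟨g₁, os₁, k₁, h⟩)
      F θ hP ⟨hG, hP, hfs⟩ hθ
    obtain ⟨M, ρ₁, hM, hρ₁, hu⟩ := hunif
    exact (forSmallCouplings_h19HolderD4_datumOfRecord₁₃CoPH_of_linkReadingAtCoreLedgerReading cr 𝔯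
      (fun {F} θ => G θ ∧ ∃ (hP : θ.Provisos₁₃CoPH F N) (g₀ : ℕ → ℝ) (os : List (ULoop F)) (k : ℕ),
        N22At (rateCarriersOfRecord₁₃CoPH 𝔯 F θ hP g₀ os k).u3 ∧ ReadOutAt (datumOfRecord₁₃CoPH F N θ hP) (rateCarriersOfRecord₁₃CoPH 𝔯 F θ hP g₀ os k).u3 ∧
          (rateCarriersOfRecord₁₃CoPH 𝔯 F θ hP g₀ os k).u3.ρ < 1)
      hβ1 (fun F θ hP hG' => hlinkCore F θ hP hG'.1) hβ23 hpin1 ℓ hpinU3 hpinL hmatch hend hradii hclass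
      (hdecT_of_u3Pinned_of_kernelDecayAll_of_faceSomewhere 𝔯 _ ℓ hpinU3 (fun F θ hP hG' hθ => h510 F θ hP hG'.1 hθ)
        fun F θ hP hG' _ => let ⟨_, g₁, os₁, k₁, h⟩ := hG'.2; ⟨g₁, os₁, k₁, h⟩)
      F θ hP ⟨hG, hP, hfs⟩ hθ hγ₀ hb0 hβ hM hρ₁ hu).mono fun g₀ h os => h os (ks F θ hP g₀ os)
  · exact ForSmallCouplings.of_forall fun g₀ os hface =>
      absurd ⟨g₀, os, ks F θ hP g₀ os, hface.1.2.2.2.2.2, hface.2.1, hface.2.2.2⟩ hfs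

end Slot

end Summit.QuantumFields.YangMills.BalabanUVNodes.N19CoreEdgeU3InputsFromFaceAtPin

end
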